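import Summits.Ventures.CertifiedManyBodySolver.Downfold.EmeryBandLevelU
import Summits.Ventures.CertifiedManyBodySolver.Downfold.EmeryOrbitalWeightCheck
import HarnessLib

/-!
# The band-level interaction over a CERTIFIED weight window: the kernel-decidable rule `ubCheck` and the U leg of technique B read at the
# certified Fermi-surface Cu-d weight of a typed σ set (`dwCheck` ∘ `bandLevelU`)

Venture CertifiedManyBodySolver, cell `pub/hubbard-downfold` (stage S1 = ROUTER; INFLATION-RULES-3to1-B §B.4/§B.24: the U leg of the three-band →
one-band reduction), seat hubbard-downfold-mod-4; namespace `Summit.Ventures.CertifiedManyBodySolver.Downfold.Emery`. Sequel of `EmeryBandLevelU`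
(`bandLevelU w U_dd U_pp U_pd = w²U_dd + (1−w)²U_pp/4 + 2w(1−w)U_pd`, the box rule `bandLevelU_mem_Icc_increasing`) and `EmeryOrbitalWeightCheck`
(`dwCheck`: certified windows for the Cu-d weight `dWeight` of the σ antibonding Bloch state at the node, at the antinode and on the whole Fermi
surface). Everything here is PROVED (0 sorry). WHAT THIS IS NOT: a cRPA or screening statement; `bandLevelU` is the MEAN-FIELD PROJECTION of typed
three-band density–density interactions onto the conduction band at Cu-d weight `w` — an ANNEX of technique B; no number lives here.

* `bandLevelUQ` (exact rational value, `cast_bandLevelUQ`); `ubCheck w₁ w₂ d p x lo hi` = `0 ≤ w₁ ≤ w₂ ≤ 1`, convexity `κ = d + p/4 − 2x ≥ 0`,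
  increasing at `w₁` (`p/4 − x ≤ κ·w₁`), and `lo ≤ U_B(w₁)`, `U_B(w₂) ≤ hi`; SOUNDNESS `bandLevelU_mem_of_ubCheck`: `w ∈ [w₁, w₂] ⇒ U_B(w) ∈ [lo, hi]`;
  strict readings against a number `U` (`bandLevelU_lt_of_ubCheck`, `lt_bandLevelU_of_ubCheck`).
* THE U LEG AT A CERTIFIED WEIGHT: `dWeightFS_hull_of_dwCheck` (the Fermi-surface d-weight hull `[wlo, whi]` with rational ends discharged on ℚ) and
  `bandLevelU_FS_of_checks` — under `dwCheck` and `ubCheck wlo whi …`, for every `ε` in the piece and EVERY zone Fermi point `k_F`, `U_B(w_d(k_F)) ∈ [lo, hi]`;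
  the nodal / antinodal versions `bandLevelU_node_of_checks`, `bandLevelU_face_of_checks` (`fdCheck` convention).

Sources: three-band model [HybertsenSchluterChristensen1989, Eq. (1)]; [AndersenEtAl1995, §6]; interval arithmetic [folklore] (Moore 1966).
-/

noncomputable section

namespace Summit.Ventures.CertifiedManyBodySolver.Downfold.Emery

open Real Set

/-- Exact rational value of `bandLevelU` at rational arguments. [folklore] -/
def bandLevelUQ (w d p x : ℚ) : ℚ := w ^ 2 * d + (1 - w) ^ 2 * p / 4 + 2 * w * (1 - w) * x

/-- `bandLevelUQ` casts to `bandLevelU`. [folklore] -/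
theorem cast_bandLevelUQ (w d p x : ℚ) : ((bandLevelUQ w d p x : ℚ) : ℝ) = bandLevelU (w : ℝ) d p x := by
  unfold bandLevelUQ bandLevelU
  push_cast
  ring

/-- **`ubCheck`** — the kernel-decidable rule for `U_B` over a weight window `[w₁, w₂]` at POINT interactions `(d, p, x) = (U_dd, U_pp, U_pd)`:
`0 ≤ w₁ ≤ w₂ ≤ 1`, convex (`d + p/4 − 2x ≥ 0`), increasing at `w₁` (`p/4 − x ≤ (d + p/4 − 2x)·w₁`), and the claimed window `lo ≤ U_B(w₁)`, `U_B(w₂) ≤ hi`.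
[folklore] -/
def ubCheck (w₁ w₂ d p x lo hi : ℚ) : Bool :=
  decide (0 ≤ w₁) && decide (w₁ ≤ w₂) && decide (w₂ ≤ 1) && decide (0 ≤ d + p / 4 - 2 * x) &&
  decide (p / 4 - x ≤ (d + p / 4 - 2 * x) * w₁) &&
  decide (lo ≤ bandLevelUQ w₁ d p x) && decide (bandLevelUQ w₂ d p x ≤ hi)

/-- **SOUNDNESS of `ubCheck`**: every weight in the window gives `U_B ∈ [lo, hi]`. [folklore] -/
theorem bandLevelU_mem_of_ubCheck {w₁ w₂ d p x lo hi : ℚ} (h : ubCheck w₁ w₂ d p x lo hi = true) {w : ℝ}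
    (hw : w ∈ Set.Icc (w₁ : ℝ) w₂) : bandLevelU w d p x ∈ Set.Icc (lo : ℝ) hi := by
  simp only [ubCheck, Bool.and_eq_true, decide_eq_true_eq] at h
  obtain ⟨⟨⟨⟨⟨⟨h0, -⟩, h1⟩, hκ⟩, hder⟩, hlo⟩, hhi⟩ := h
  have hd : (d : ℝ) ∈ Set.Icc (d : ℝ) d := ⟨le_rfl, le_rfl⟩
  have hp : (p : ℝ) ∈ Set.Icc (p : ℝ) p := ⟨le_rfl, le_rfl⟩
  have hx : (x : ℝ) ∈ Set.Icc (x : ℝ) x := ⟨le_rfl, le_rfl⟩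
  have hκ' : (0 : ℝ) ≤ (d : ℝ) + (p : ℝ) / 4 - 2 * (x : ℝ) := by exact_mod_cast hκ
  have hder' : (p : ℝ) / 4 - (x : ℝ) ≤ ((d : ℝ) + (p : ℝ) / 4 - 2 * (x : ℝ)) * (w₁ : ℝ) := by exact_mod_cast hder
  have H := bandLevelU_mem_Icc_increasing (by exact_mod_cast h0) (by exact_mod_cast h1) hw hd hp hx hκ' hder' hκ' hder'
  rw [← cast_bandLevelUQ, ← cast_bandLevelUQ] at H
  exact ⟨le_trans (by exact_mod_cast hlo) H.1, H.2.trans (by exact_mod_cast hhi)⟩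

/-- Strict reading ABOVE: under `ubCheck` with `hi < U`, every weight in the window gives `U_B < U`. [folklore] -/
theorem bandLevelU_lt_of_ubCheck {w₁ w₂ d p x lo hi U : ℚ} (h : ubCheck w₁ w₂ d p x lo hi = true) (hU : hi < U) {w : ℝ}
    (hw : w ∈ Set.Icc (w₁ : ℝ) w₂) : bandLevelU w d p x < U :=
  lt_of_le_of_lt (bandLevelU_mem_of_ubCheck h hw).2 (by exact_mod_cast hU)

/-- Strict reading BELOW: under `ubCheck` with `U < lo`, every weight in the window gives `U < U_B`. [folklore] -/
theorem lt_bandLevelU_of_ubCheck {w₁ w₂ d p x lo hi U : ℚ} (h : ubCheck w₁ w₂ d p x lo hi = true) (hU : U < lo) {w : ℝ}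
    (hw : w ∈ Set.Icc (w₁ : ℝ) w₂) : (U : ℝ) < bandLevelU w d p x :=
  lt_of_lt_of_le (by exact_mod_cast hU) (bandLevelU_mem_of_ubCheck h hw).1

/-- **The Fermi-surface d-weight hull with explicit rational ends**: under `dwCheck` and `wlo ≤ wnlo, walo`, `wnhi, wahi ≤ whi`, every zone Fermi point of
every `ε` in the piece has positive energy denominator and `w_d ∈ [wlo, whi]` (`dWeightFS_of_dwCheck` with the `min`/`max` discharged on ℚ). [folklore] -/
theorem dWeightFS_hull_of_dwCheck {Δ a b c e₁ e₂ wnlo wnhi walo wahi wlo whi : ℚ}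
    (h : dwCheck Δ a b c e₁ e₂ wnlo wnhi walo wahi = true) (hl₁ : wlo ≤ wnlo) (hl₂ : wlo ≤ walo) (hh₁ : wnhi ≤ whi) (hh₂ : wahi ≤ whi)
    {ε u v : ℝ} (he : ε ∈ Set.Icc (e₁ : ℝ) e₂) (hu : u ∈ Set.Icc (0 : ℝ) 1) (hv : v ∈ Set.Icc (0 : ℝ) 1)
    (hP : charCubic (Δ : ℝ) a b c u v ε = 0) :
    0 < dcharCubic (Δ : ℝ) a b c u v ε ∧ dWeight (Δ : ℝ) a b c u v ε ∈ Set.Icc (wlo : ℝ) whi := by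
  obtain ⟨hW, hw⟩ := dWeightFS_of_dwCheck h he hu hv hP
  refine ⟨hW, ?_, ?_⟩
  · exact le_trans (le_min (by exact_mod_cast hl₁) (by exact_mod_cast hl₂)) hw.1
  · exact hw.2.trans (max_le (by exact_mod_cast hh₁) (by exact_mod_cast hh₂))

/-- **THE U LEG AT THE CERTIFIED FERMI-SURFACE WEIGHT.** Under `dwCheck` (σ point, energy piece, d-weight windows), a rational hull `[wlo, whi]` of the two
windows and `ubCheck wlo whi d p x lo hi`: for every `ε` in the piece and EVERY zone Fermi point `(u, v) ∈ [0, 1]²` of the `ε`-contour, `U_B(w_d(u, v)) ∈ [lo, hi]`.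
[folklore] -/
theorem bandLevelU_FS_of_checks {Δ a b c e₁ e₂ wnlo wnhi walo wahi wlo whi d p x lo hi : ℚ}
    (hdw : dwCheck Δ a b c e₁ e₂ wnlo wnhi walo wahi = true) (hl₁ : wlo ≤ wnlo) (hl₂ : wlo ≤ walo) (hh₁ : wnhi ≤ whi) (hh₂ : wahi ≤ whi)
    (hub : ubCheck wlo whi d p x lo hi = true)
    {ε u v : ℝ} (he : ε ∈ Set.Icc (e₁ : ℝ) e₂) (hu : u ∈ Set.Icc (0 : ℝ) 1) (hv : v ∈ Set.Icc (0 : ℝ) 1)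
    (hP : charCubic (Δ : ℝ) a b c u v ε = 0) :
    bandLevelU (dWeight (Δ : ℝ) a b c u v ε) d p x ∈ Set.Icc (lo : ℝ) hi :=
  bandLevelU_mem_of_ubCheck hub (dWeightFS_hull_of_dwCheck hdw hl₁ hl₂ hh₁ hh₂ he hu hv hP).2

/-- The U leg at the NODAL weight: under `dwCheck` and `ubCheck wnlo wnhi …`, for every `ε` in the piece and every nodal contour point `(x_n, x_n)`
(`x_n ≥ 0`; an antinodal point `(1, y_a)` is also assumed, `fdCheck` convention): `U_B(w_d(node)) ∈ [lo, hi]`. [folklore] -/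
theorem bandLevelU_node_of_checks {Δ a b c e₁ e₂ wnlo wnhi walo wahi d p x lo hi : ℚ}
    (hdw : dwCheck Δ a b c e₁ e₂ wnlo wnhi walo wahi = true) (hub : ubCheck wnlo wnhi d p x lo hi = true)
    {ε xn ya : ℝ} (he : ε ∈ Set.Icc (e₁ : ℝ) e₂) (hxn : 0 ≤ xn)
    (hPn : charCubic (Δ : ℝ) a b c xn xn ε = 0) (hPa : charCubic (Δ : ℝ) a b c 1 ya ε = 0) :
    bandLevelU (dWeight (Δ : ℝ) a b c xn xn ε) d p x ∈ Set.Icc (lo : ℝ) hi := by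
  obtain ⟨-, -, hw, -⟩ := dWeight_of_dwCheck hdw he hxn hPn hPa
  exact bandLevelU_mem_of_ubCheck hub hw

/-- The U leg at the ANTINODAL weight: under `dwCheck` and `ubCheck walo wahi …`, for every `ε` in the piece and every antinodal contour point
`(1, y_a)` (a nodal point assumed alongside): `U_B(w_d(antinode)) ∈ [lo, hi]`. [folklore] -/
theorem bandLevelU_face_of_checks {Δ a b c e₁ e₂ wnlo wnhi walo wahi d p x lo hi : ℚ}
    (hdw : dwCheck Δ a b c e₁ e₂ wnlo wnhi walo wahi = true) (hub : ubCheck walo wahi d p x lo hi = true)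
    {ε xn ya : ℝ} (he : ε ∈ Set.Icc (e₁ : ℝ) e₂) (hxn : 0 ≤ xn)
    (hPn : charCubic (Δ : ℝ) a b c xn xn ε = 0) (hPa : charCubic (Δ : ℝ) a b c 1 ya ε = 0) :
    bandLevelU (dWeight (Δ : ℝ) a b c 1 ya ε) d p x ∈ Set.Icc (lo : ℝ) hi := by
  obtain ⟨-, -, -, hw⟩ := dWeight_of_dwCheck hdw he hxn hPn hPa
  exact bandLevelU_mem_of_ubCheck hub hw

end Summit.Ventures.CertifiedManyBodySolver.Downfold.Emery
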